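import Mathlib
import Summits.ValiantsHypothesis.ValiantsHypothesis.Theorems.RigidityForcesSymmetryRankRigidMinimalReprStubLevelBoundBlocks

/-!
# Stub `stub_levelBound` of crux `RankRigidMinimalRepr` (stmt-ValiantsHypothesis-18034), line `PairTiedTorusBound`
# — part 2: the double count and the registered stub

Route `ValiantsHypothesis/RigidityForcesSymmetry`, crux `RankRigidMinimalRepr` (stmt-ValiantsHypothesis-18034), forward
rung `PairTiedTorusBound`, registered stub (verbatim signature, against the tree copy
`Theorems.RigidityForcesSymmetryPairTiedTorusBound.TiedLevelDecomposable` of the workfile's definition):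

  `theorem stub_levelBound : ∀ m : ℕ, 3 ≤ m → ∀ s w : ℕ, 1 ≤ s → s + 1 ≤ m → TiedLevelDecomposable m 1 s w → m.choose s ≤ w`

**Proof (double count over the `2 × 2` blocks of part 1, `…StubLevelBoundBlocks.lean`).**  Fix a level-`s` typed
decomposition `perm_{n+2} = Σ_{t<w} P_t Q_t` with the columns `0, 1` tied.  Say node `t` TOUCHES `σ` if its block at
`σ` (coefficients of the graph monomials of `σ[p ↦ a, q ↦ b]`, `a, b ∈ {0,1}`, in `P_t Q_t`) is non-zero, and give it
WEIGHT `1` if its type is tied (`ct t = 1`) and `2` otherwise.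
* DEMAND (`two_le_sum_score`): every `σ` collects weight `≥ 2`.  The permanent's block `[[0,1],[1,0]]` is the sum of
  the blocks of the touching nodes; a touching node of tied type separates `p, q` and has a block of zero
  determinant (part 1), and `[[0,1],[1,0]]` is neither zero nor of zero determinant — so either a node of weight `2`
  touches `σ`, or at least two nodes do.
* SUPPLY (`sum_score_le`): a node collects, over all `σ`, at most `2 · s!(n+2-s)!`: a touched `σ` maps `I_t` onto
  `C_t ∪ E` (`C_t` = untied columns of profile `1`, `E ⊆ {0,1}` of size `ct t`, part 1), i.e. onto one of `≤ 2`
  candidates if `ct t = 1` and `≤ 1` candidate otherwise, and each candidate is hit by `≤ s!(n+2-s)!` permutations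
  (`card_perm_map_eq_le`, the tree's `BorderApolarityToricWitnessObstructionQP.torusBound_card_perm_map_le` re-proved here
  to keep this file outside the Theses cone of route `RigidityForcesSymmetry`).
* COUNT (`choose_le_of_typed_decomposition`): `2 · (n+2)! ≤ w · 2 · s!(n+2-s)!`, i.e. `C(n+2, s) ≤ w`.
The stub follows with `m = n + 2` (`m ≥ 3` gives `m ≥ 2`; `1 ≤ s` and the complementarity clauses of
`TiedLevelDecomposable` are not used).

RELATION TO THE FLOOR'S COUNT.  For the full torus (no tie) the level count is the tree's pigeonhole
`RigidityForcesSymmetryRigidMinimalRepr.levelCard_choose_le` / `stub_levelCard` (and `torusBound_levelCount`): a type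
`(I, J)` serves only the `s!(m-s)!` permutations with `σ(I) = J`.  The tie `k = 1` MERGES the types `(I, J ∪ {0})` and
`(I, J ∪ {1})` into one tied type serving `2 · s!(m-s)!` permutations, so served-counting alone certifies only
`C(m,s)/2` products; the block count of this file shows the merge buys nothing (a tied product serving both
completions of a block alone would have to carry the rank-two pattern `[[0,1],[1,0]]` on it).

HONEST FRAMING: ONE registered stub of a forward rung (Grenet's bound `2^m - 1` for `perm_m` under the two-sided
torus with one pair of column scalars tied) — the «new mathematics» half; the rung `PairTiedTorusBound` still needs
the dictionary stub `stub_levelDecomp` (equivariant representation ⇒ typed level decompositions).  No bearing on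
`VP ≠ VNP`.  Nearest literature: Nisan 1991 (rank method), Landsberg–Ressayre 2017 §6; the count is route mathematics.
-/

set_option autoImplicit false

-- the mandated summit-side namespace repeats a component by design (single-problem summit)
set_option linter.dupNamespace false

open MvPolynomial Finset
open Literature.Computability.AlgebraicComplexity
open Summit.ValiantsHypothesis.ValiantsHypothesis.Theorems.RigidityForcesSymmetryPairTiedTorusBound

namespace Summit.ValiantsHypothesis.ValiantsHypothesis.Theorems.RigidityForcesSymmetryRankRigidMinimalRepr

noncomputable section

open scoped Classical

variable {n w s : ℕ} (I : Fin w → Finset (Fin (n + 2))) (c c' : Fin w → Fin (n + 2) → ℕ) (ct ct' : Fin w → ℕ)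
  (P Q : Fin w → MvPolynomial (Fin (n + 2) × Fin (n + 2)) ℂ)

/-- At most `|I|! (m - |I|)!` permutations of `[m]` map `I` onto `J` (restriction to `I` and to its complement is
injective into `(I ≃ J) × (Iᶜ ≃ Jᶜ)`).  Same statement and proof as the tree's
`BorderApolarityToricWitnessObstructionQP.torusBound_card_perm_map_le` (adapted from
`Theorems/BorderApolarityToricWitnessObstructionQPStubTorusBound.lean`), repeated so that this file does not import a
module in a Theses cone. [folklore] -/
theorem card_perm_map_eq_le {m : ℕ} (I J : Finset (Fin m)) :
    (Finset.univ.filter fun σ : Equiv.Perm (Fin m) => I.map σ.toEmbedding = J).card ≤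
      I.card.factorial * (m - I.card).factorial := by
  by_cases hne : (Finset.univ.filter fun σ : Equiv.Perm (Fin m) => I.map σ.toEmbedding = J) = ∅
  · rw [hne, Finset.card_empty]; exact Nat.zero_le _
  obtain ⟨τ, hτ⟩ := Finset.nonempty_iff_ne_empty.2 hne
  rw [Finset.mem_filter] at hτ
  have hIJ : I.card = J.card := by rw [← hτ.2, Finset.card_map]
  have key : ∀ σ : Equiv.Perm (Fin m), I.map σ.toEmbedding = J → ∀ a, a ∈ I ↔ σ a ∈ J := by
    intro σ hσ a
    rw [← hσ, Finset.mem_map_equiv, Equiv.symm_apply_apply]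
  let S := {σ : Equiv.Perm (Fin m) // I.map σ.toEmbedding = J}
  let F : S → (↥I ≃ ↥J) × ({a // a ∉ I} ≃ {b // b ∉ J}) := fun σ =>
    (σ.1.subtypeEquiv (fun a => key σ.1 σ.2 a), σ.1.subtypeEquiv (fun a => not_congr (key σ.1 σ.2 a)))
  have hF : Function.Injective F := by
    rintro ⟨σ, hσ⟩ ⟨σ', hσ'⟩ h
    simp only [Prod.mk.injEq, F] at h
    apply Subtype.ext
    refine Equiv.ext fun a => ?_
    by_cases ha : a ∈ I
    · have := congrArg (fun e : ↥I ≃ ↥J => ((e ⟨a, ha⟩ : ↥J) : Fin m)) h.1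
      simpa using this
    · have := congrArg (fun e : {a // a ∉ I} ≃ {b // b ∉ J} => ((e ⟨a, ha⟩ : {b // b ∉ J}) : Fin m)) h.2
      simpa using this
  have eI : ↥I ≃ ↥J := Finset.equivOfCardEq hIJ
  have eIc : {a // a ∉ I} ≃ {b // b ∉ J} := Fintype.equivOfCardEq (by
    rw [Fintype.card_subtype_compl, Fintype.card_subtype_compl, Fintype.card_coe, Fintype.card_coe,
      hIJ])
  calc (Finset.univ.filter fun σ : Equiv.Perm (Fin m) => I.map σ.toEmbedding = J).card
      = Fintype.card S := (Fintype.card_subtype _).symm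
    _ ≤ Fintype.card ((↥I ≃ ↥J) × ({a // a ∉ I} ≃ {b // b ∉ J})) :=
        Fintype.card_le_of_injective F hF
    _ = I.card.factorial * (m - I.card).factorial := by
        rw [Fintype.card_prod, Fintype.card_equiv eI, Fintype.card_equiv eIc, Fintype.card_coe,
          Fintype.card_subtype_compl, Fintype.card_coe, Fintype.card_fin]

/-! ### §1 Supply: a node scores at most `2 · s! (n+2-s)!`

Node `t` TOUCHES `σ` when its `2 × 2` block at `σ` (the coefficients of the graph monomials of `σ[p ↦ a, q ↦ b]`,
`a, b ∈ {0, 1}`, in `P_t · Q_t`) is non-zero; its SCORE at `σ` is then its WEIGHT — `1` for a tied type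
(`ct t = 1`), `2` otherwise — and `0` if it does not touch.  (All three notions are written out in the statements.) -/

/-- The tied-column patterns `E ⊆ {0, 1}` (as pairs of Booleans) of a given size `k ≠ 1`: at most one. -/
theorem card_tiedPatterns_le_one (k : ℕ) (hk : k ≠ 1) :
    ((Finset.univ : Finset (Bool × Bool)).filter
      (fun e => (if e.1 then 1 else 0) + (if e.2 then 1 else 0) = k)).card ≤ 1 := by
  refine Finset.card_le_one.2 fun a ha b hb => ?_
  rw [Finset.mem_filter] at ha hb
  obtain ⟨a1, a2⟩ := a
  obtain ⟨b1, b2⟩ := b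
  cases a1 <;> cases a2 <;> cases b1 <;> cases b2 <;> simp_all <;> omega

/-- The tied-column patterns of size `1`: two (`{0}` and `{1}`). -/
theorem card_tiedPatterns_one_le :
    ((Finset.univ : Finset (Bool × Bool)).filter
      (fun e => (if e.1 then 1 else 0) + (if e.2 then 1 else 0) = 1)).card ≤ 2 := by
  decide

/-- **Supply.**  A node `t` of a level-`s` typed decomposition (tie `k = 1`) scores at most `2 · s! · (n+2-s)!` over
all permutations: a touched `σ` maps `I_t` onto `C_t ∪ E` with `C_t` the untied columns of profile `1` and `E` a
set of tied columns of size `ct t` (`symm_mem_iff_of_mem_support`, `ct_eq_of_mem_support`) — two candidates of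
weight `1` for a tied type, one candidate of weight `2` for an exact type (`ct t ∈ {0, 2}`), none otherwise — and
each candidate image is attained by at most `s!(n+2-s)!` permutations (`card_perm_map_eq_le`). -/
theorem sum_score_le {t : Fin w} (hcard : (I t).card = s)
    (hP : IsTiedTyped (n + 2) 1 (I t) (c t) (ct t) (P t))
    (hQ : IsTiedTyped (n + 2) 1 (I t)ᶜ (c' t) (ct' t) (Q t)) :
    (∑ σ : Equiv.Perm (Fin (n + 2)),
      if (∃ a b : Fin (n + 2), a.val ≤ 1 ∧ b.val ≤ 1 ∧ coeff (graphMonomial (tau σ a b)) (P t * Q t) ≠ 0)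
      then (if ct t = 1 then 1 else 2) else 0) ≤ 2 * (s.factorial * (n + 2 - s).factorial) := by
  -- the candidate images `σ(I t)` of a touched `σ`
  set cand : Finset (Finset (Fin (n + 2))) := ((Finset.univ : Finset (Bool × Bool)).filter
      (fun e => (if e.1 then 1 else 0) + (if e.2 then 1 else 0) = ct t)).image
    (fun e => (Finset.univ.filter fun j : Fin (n + 2) => 1 < j.val ∧ c t j = 1) ∪
      ((if e.1 then {0} else ∅) ∪ (if e.2 then {1} else ∅))) with hcand
  -- (1) a touched permutation maps `I t` onto a candidate
  have hmem : ∀ σ : Equiv.Perm (Fin (n + 2)),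
      (∃ a b : Fin (n + 2), a.val ≤ 1 ∧ b.val ≤ 1 ∧ coeff (graphMonomial (tau σ a b)) (P t * Q t) ≠ 0) →
      (I t).map σ.toEmbedding ∈ cand := by
    rintro σ ⟨a, b, ha, hb, hne⟩
    rw [coeff_graphMonomial_mul_of_isTiedTyped hP hQ] at hne
    have hsupp : graphMonomialOn (I t) (tau σ a b) ∈ (P t).support :=
      mem_support_iff.2 (left_ne_zero_of_mul hne)
    rw [hcand, Finset.mem_image]
    refine ⟨(decide (σ.symm 0 ∈ I t), decide (σ.symm 1 ∈ I t)), ?_, ?_⟩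
    · rw [Finset.mem_filter]
      refine ⟨Finset.mem_univ _, ?_⟩
      rw [ct_eq_of_mem_support hP σ ha hb hsupp]
      by_cases hp : σ.symm 0 ∈ I t <;> by_cases hq : σ.symm 1 ∈ I t <;> simp [hp, hq]
    · ext j
      rw [Finset.mem_map_equiv, Finset.mem_union, Finset.mem_union, Finset.mem_filter]
      by_cases hj : 1 < j.val
      · have hj0 : j ≠ 0 := fun h => by rw [h] at hj; exact absurd hj (by simp)
        have hj1 : j ≠ 1 := fun h => by rw [h] at hj; exact absurd hj (by simp)
        rw [symm_mem_iff_of_mem_support hP σ ha hb hsupp hj]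
        by_cases hp : σ.symm 0 ∈ I t <;> by_cases hq : σ.symm 1 ∈ I t <;> simp [hp, hq, hj, hj0, hj1]
      · have hj' : j = 0 ∨ j = 1 := by
          rcases Nat.le_one_iff_eq_zero_or_eq_one.1 (not_lt.1 hj) with h | h
          · exact Or.inl (Fin.ext h)
          · exact Or.inr (Fin.ext h)
        have h01 : (0 : Fin (n + 2)) ≠ 1 := by simp
        rcases hj' with rfl | rfl
        · by_cases hp : σ.symm 0 ∈ I t <;> by_cases hq : σ.symm 1 ∈ I t <;> simp [hp, hq, h01]
        · by_cases hp : σ.symm 0 ∈ I t <;> by_cases hq : σ.symm 1 ∈ I t <;> simp [hp, hq, h01.symm]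
  -- (2) hence at most `|cand| · s!(n+2-s)!` permutations are touched
  have hT : (Finset.univ.filter fun σ : Equiv.Perm (Fin (n + 2)) =>
        ∃ a b : Fin (n + 2), a.val ≤ 1 ∧ b.val ≤ 1 ∧ coeff (graphMonomial (tau σ a b)) (P t * Q t) ≠ 0).card
      ≤ cand.card * (s.factorial * (n + 2 - s).factorial) := by
    calc (Finset.univ.filter fun σ : Equiv.Perm (Fin (n + 2)) =>
          ∃ a b : Fin (n + 2), a.val ≤ 1 ∧ b.val ≤ 1 ∧ coeff (graphMonomial (tau σ a b)) (P t * Q t) ≠ 0).card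
        ≤ (cand.biUnion fun J =>
            Finset.univ.filter fun σ : Equiv.Perm (Fin (n + 2)) => (I t).map σ.toEmbedding = J).card := by
          refine Finset.card_le_card fun σ hσ => ?_
          rw [Finset.mem_filter] at hσ
          rw [Finset.mem_biUnion]
          exact ⟨_, hmem σ hσ.2, Finset.mem_filter.2 ⟨Finset.mem_univ _, rfl⟩⟩
      _ ≤ ∑ J ∈ cand,
            (Finset.univ.filter fun σ : Equiv.Perm (Fin (n + 2)) => (I t).map σ.toEmbedding = J).card :=
          Finset.card_biUnion_le
      _ ≤ ∑ _J ∈ cand, s.factorial * (n + 2 - s).factorial :=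
          Finset.sum_le_sum fun J _ => by
            have := card_perm_map_eq_le (I t) J
            rwa [hcard] at this
      _ = cand.card * (s.factorial * (n + 2 - s).factorial) := by
          rw [Finset.sum_const, smul_eq_mul]
  -- (3) weight · |cand| ≤ 2
  have hwc : (if ct t = 1 then 1 else 2) * cand.card ≤ 2 := by
    have hle : cand.card ≤ ((Finset.univ : Finset (Bool × Bool)).filter
        (fun e => (if e.1 then 1 else 0) + (if e.2 then 1 else 0) = ct t)).card :=
      Finset.card_image_le
    by_cases h1 : ct t = 1
    · rw [if_pos h1, one_mul]
      refine hle.trans ?_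
      rw [h1]
      exact card_tiedPatterns_one_le
    · rw [if_neg h1]
      have := hle.trans (card_tiedPatterns_le_one (ct t) h1)
      omega
  -- (4) the sum is `weight · #touched`
  rw [Finset.sum_ite, Finset.sum_const_zero, add_zero, Finset.sum_const, smul_eq_mul, mul_comm]
  calc (if ct t = 1 then 1 else 2) * (Finset.univ.filter fun σ : Equiv.Perm (Fin (n + 2)) =>
          ∃ a b : Fin (n + 2), a.val ≤ 1 ∧ b.val ≤ 1 ∧ coeff (graphMonomial (tau σ a b)) (P t * Q t) ≠ 0).card
      ≤ (if ct t = 1 then 1 else 2) * (cand.card * (s.factorial * (n + 2 - s).factorial)) :=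
        Nat.mul_le_mul_left _ hT
    _ = ((if ct t = 1 then 1 else 2) * cand.card) * (s.factorial * (n + 2 - s).factorial) := by ring
    _ ≤ 2 * (s.factorial * (n + 2 - s).factorial) := Nat.mul_le_mul_right _ hwc

/-! ### §2 Demand: every permutation is scored at least `2` -/

/-- **Demand.**  In a level-`s` typed decomposition `perm = Σ_t P_t Q_t` (tie `k = 1`) every permutation `σ` has
total score `≥ 2`: on its block the permanent is `[[0, 1], [1, 0]]` (`coeff_tau_*_perPoly`), of non-zero determinant;
a touching node of tied type separates `p, q` (`ct_eq_of_mem_support`) and contributes a block of zero determinant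
(`block_det_eq_of_separates`); so either a node of weight `2` touches `σ`, or at least two nodes do. -/
theorem two_le_sum_score (hP : ∀ t, IsTiedTyped (n + 2) 1 (I t) (c t) (ct t) (P t))
    (hQ : ∀ t, IsTiedTyped (n + 2) 1 (I t)ᶜ (c' t) (ct' t) (Q t))
    (hperm : perPoly (Fin (n + 2)) ℂ = ∑ t, P t * Q t) (σ : Equiv.Perm (Fin (n + 2))) :
    2 ≤ ∑ t : Fin w,
      if (∃ a b : Fin (n + 2), a.val ≤ 1 ∧ b.val ≤ 1 ∧ coeff (graphMonomial (tau σ a b)) (P t * Q t) ≠ 0)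
      then (if ct t = 1 then 1 else 2) else 0 := by
  by_contra hlt
  rw [not_le] at hlt
  set S := Finset.univ.filter fun t : Fin w =>
    ∃ a b : Fin (n + 2), a.val ≤ 1 ∧ b.val ≤ 1 ∧ coeff (graphMonomial (tau σ a b)) (P t * Q t) ≠ 0 with hS
  -- the permanent's block is the sum of the blocks of the touching nodes
  have hJ : ∀ a b : Fin (n + 2), a.val ≤ 1 → b.val ≤ 1 →
      coeff (graphMonomial (tau σ a b)) (perPoly (Fin (n + 2)) ℂ) =
        ∑ t ∈ S, coeff (graphMonomial (tau σ a b)) (P t * Q t) := by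
    intro a b ha hb
    rw [hperm, coeff_sum]
    refine (Finset.sum_subset (Finset.filter_subset _ _) fun t _ ht => ?_).symm
    by_contra hne
    exact ht (Finset.mem_filter.2 ⟨Finset.mem_univ _, a, b, ha, hb, hne⟩)
  -- the total score bounds the number of touching nodes and forces them to be of tied type
  have hscore : (∑ t : Fin w,
      if (∃ a b : Fin (n + 2), a.val ≤ 1 ∧ b.val ≤ 1 ∧ coeff (graphMonomial (tau σ a b)) (P t * Q t) ≠ 0)
      then (if ct t = 1 then 1 else 2) else 0) = ∑ t ∈ S, (if ct t = 1 then 1 else 2) := by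
    rw [Finset.sum_ite, Finset.sum_const_zero, add_zero]
  have hS1 : S.card ≤ 1 := by
    have : S.card ≤ ∑ t ∈ S, (if ct t = 1 then 1 else 2) := by
      rw [Finset.card_eq_sum_ones]
      exact Finset.sum_le_sum fun t _ => by split_ifs <;> omega
    omega
  have hct : ∀ t ∈ S, ct t = 1 := by
    intro t ht
    by_contra h
    have : (if ct t = 1 then 1 else 2) ≤ ∑ t ∈ S, (if ct t = 1 then 1 else 2) :=
      Finset.single_le_sum (f := fun t => if ct t = 1 then 1 else 2) (fun _ _ => Nat.zero_le _) ht
    rw [if_neg h] at this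
    omega
  rcases S.eq_empty_or_nonempty with hS0 | ⟨t₀, ht₀⟩
  · -- no node touches `σ`: the `(0, 1)` entry of the permanent's block would vanish
    have := hJ 0 1 (by simp) (by simp)
    rw [coeff_tau_zero_one_perPoly, hS0, Finset.sum_empty] at this
    exact one_ne_zero this
  · -- exactly one node `t₀`, of tied type, touches `σ`: its block (zero determinant) would be `[[0,1],[1,0]]`
    have hSt : S = {t₀} :=
      Finset.eq_singleton_iff_unique_mem.2 ⟨ht₀, fun t ht => Finset.card_le_one.1 hS1 t ht t₀ ht₀⟩
    obtain ⟨a, b, ha, hb, hne⟩ := (Finset.mem_filter.1 ht₀).2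
    rw [coeff_graphMonomial_mul_of_isTiedTyped (hP t₀) (hQ t₀)] at hne
    have hsupp : graphMonomialOn (I t₀) (tau σ a b) ∈ (P t₀).support :=
      mem_support_iff.2 (left_ne_zero_of_mul hne)
    have hct₀ := ct_eq_of_mem_support (hP t₀) σ ha hb hsupp
    rw [hct t₀ ht₀] at hct₀
    have hsep : (σ.symm 0 ∈ I t₀ ∧ σ.symm 1 ∉ I t₀) ∨ (σ.symm 0 ∉ I t₀ ∧ σ.symm 1 ∈ I t₀) := by
      by_cases hp : σ.symm 0 ∈ I t₀ <;> by_cases hq : σ.symm 1 ∈ I t₀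
      · rw [if_pos hp, if_pos hq] at hct₀; simp at hct₀
      · exact Or.inl ⟨hp, hq⟩
      · exact Or.inr ⟨hp, hq⟩
      · rw [if_neg hp, if_neg hq] at hct₀; simp at hct₀
    have hdet := block_det_eq_of_separates (hP t₀) (hQ t₀) σ hsep
    have h00 := hJ 0 0 (by simp) (by simp)
    have h11 := hJ 1 1 (by simp) (by simp)
    have h01 := hJ 0 1 (by simp) (by simp)
    have h10 := hJ 1 0 (by simp) (by simp)
    rw [hSt, Finset.sum_singleton] at h00 h11 h01 h10
    rw [coeff_tau_self_perPoly] at h00 h11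
    rw [coeff_tau_zero_one_perPoly] at h01
    rw [coeff_tau_one_zero_perPoly] at h10
    rw [← h00, ← h11, ← h01, ← h10] at hdet
    norm_num at hdet

/-! ### §3 The double count -/

/-- **The count** (data form of the stub): a level-`s` typed decomposition of `perm_{n+2}` with one tied pair of
columns and `w` products has `C(n+2, s) ≤ w` — demand `2 · (n+2)!` (`two_le_sum_score`) against supply
`w · 2 · s!(n+2-s)!` (`sum_score_le`), and `(n+2)! = C(n+2, s) · s! · (n+2-s)!`. -/
theorem choose_le_of_typed_decomposition (hs : s ≤ n + 2) (hcard : ∀ t, (I t).card = s)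
    (hP : ∀ t, IsTiedTyped (n + 2) 1 (I t) (c t) (ct t) (P t))
    (hQ : ∀ t, IsTiedTyped (n + 2) 1 (I t)ᶜ (c' t) (ct' t) (Q t))
    (hperm : perPoly (Fin (n + 2)) ℂ = ∑ t, P t * Q t) : (n + 2).choose s ≤ w := by
  have hF : 0 < s.factorial * (n + 2 - s).factorial :=
    Nat.mul_pos (Nat.factorial_pos _) (Nat.factorial_pos _)
  have h1 : 2 * (n + 2).factorial ≤ ∑ σ : Equiv.Perm (Fin (n + 2)), ∑ t : Fin w,
      if (∃ a b : Fin (n + 2), a.val ≤ 1 ∧ b.val ≤ 1 ∧ coeff (graphMonomial (tau σ a b)) (P t * Q t) ≠ 0)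
      then (if ct t = 1 then 1 else 2) else 0 := by
    calc 2 * (n + 2).factorial = ∑ _σ : Equiv.Perm (Fin (n + 2)), 2 := by
          rw [Finset.sum_const, smul_eq_mul, Finset.card_univ, Fintype.card_perm, Fintype.card_fin, mul_comm]
      _ ≤ _ := Finset.sum_le_sum fun σ _ => two_le_sum_score I c c' ct ct' P Q hP hQ hperm σ
  have h2 : (∑ σ : Equiv.Perm (Fin (n + 2)), ∑ t : Fin w,
      if (∃ a b : Fin (n + 2), a.val ≤ 1 ∧ b.val ≤ 1 ∧ coeff (graphMonomial (tau σ a b)) (P t * Q t) ≠ 0)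
      then (if ct t = 1 then 1 else 2) else 0) ≤ w * (2 * (s.factorial * (n + 2 - s).factorial)) := by
    rw [Finset.sum_comm]
    calc _ ≤ ∑ _t : Fin w, 2 * (s.factorial * (n + 2 - s).factorial) :=
          Finset.sum_le_sum fun t _ => sum_score_le I c c' ct ct' P Q (hcard t) (hP t) (hQ t)
      _ = w * (2 * (s.factorial * (n + 2 - s).factorial)) := by
          rw [Finset.sum_const, smul_eq_mul, Finset.card_univ, Fintype.card_fin]
  have h3 : (n + 2).choose s * (s.factorial * (n + 2 - s).factorial) ≤
      w * (s.factorial * (n + 2 - s).factorial) := by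
    have hfact : (n + 2).choose s * (s.factorial * (n + 2 - s).factorial) = (n + 2).factorial := by
      rw [← mul_assoc]; exact Nat.choose_mul_factorial_mul_factorial hs
    rw [hfact]
    have := h1.trans h2
    rw [← mul_assoc, mul_comm w 2, mul_assoc] at this
    omega
  exact Nat.le_of_mul_le_mul_right h3 hF

/-! ### §4 The registered stub -/

/-- **`stub_levelBound`** (registered stub of the crux `RankRigidMinimalRepr`, stmt-ValiantsHypothesis-18034, line
`PairTiedTorusBound`; verbatim signature): **with ONE tied pair of columns, every level-`s` typed decomposition of
`perm_m` still uses at least `C(m, s)` products.**  From `choose_le_of_typed_decomposition` (the `2 × 2`-block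
double count); of the registered hypotheses only `m ≥ 2`, `s ≤ m`, the cardinalities `|I_t| = s`, the typing of
the `P_t, Q_t` and the identity `perm_m = Σ_t P_t Q_t` are used (`1 ≤ s` and the complementarity clauses are
not needed).  HONEST FRAMING: one stub of a forward rung (Grenet's bound `2^m - 1` under a codimension-one
subtorus); the rung still needs the dictionary stub `stub_levelDecomp`; no bearing on `VP ≠ VNP`. -/
theorem stub_levelBound :
    ∀ m : ℕ, 3 ≤ m → ∀ s w : ℕ, 1 ≤ s → s + 1 ≤ m → TiedLevelDecomposable m 1 s w → m.choose s ≤ w := by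
  intro m hm s w _ hsm hdec
  obtain ⟨n, rfl⟩ : ∃ n, m = n + 2 := ⟨m - 2, by omega⟩
  obtain ⟨I, c, c', ct, ct', P, Q, hcard, hP, hQ, -, -, hperm⟩ := hdec
  exact choose_le_of_typed_decomposition I c c' ct ct' P Q (by omega) hcard hP hQ hperm

end

end Summit.ValiantsHypothesis.ValiantsHypothesis.Theorems.RigidityForcesSymmetryRankRigidMinimalRepr
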